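import Summits.AtomisticToContinuum.Crystallization.Theorems.ChartedZeroExcessLayeredLatticeLiouvilleZZZYRCR

/-!
# Charted zero-excess layered-lattice Liouville — ZZZYRCT: the per-box READER `BoxSchemeP ⟸ near enumeration + king far remainder`

Cell `decomp-a2c`, lens 2, generation 99.  With D_enum of record `D = 32` (critic r1829) the JS-D K-file proves, per box of the atlas and per
admissible word of the box, table domination of the routing scheme for the NEAR far pairs `ϱ < ‖e_x‖ ≤ D` by ENUMERATION (its own
`Δ`-rule `z₁`, decide-grade slabs per residue, tables `ΘR₁, ΘN₁`), while the pairs `‖e_x‖ > D` are routed by the KING system with the closed-form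
remainder of ZZZYRCR.  The two path systems differ, and `schemeDominatedP_of_split` (ZZZYRCL) wants ONE; this file splices them at bond length
`D` and packages the whole box obligation:

* `pathSpliceN`, `pathSpliceZ` — the spliced path data (`z₁, np₁` on `‖e_x‖ ≤ D`, `z₂, np₂` beyond); `IsPathSystemOn` — the path-system
  clauses asked only on a class; `isPathSystem_splice`; `schemeSums_congr` (the scheme sums of `x` depend on `np x`, `z x` only);
  `schemeDominatedOnP_splice_le / _gt` (class-wise domination passes to the splice);
* ★★ `boxSchemeP_of_split` — `BoxSchemeP s Λ c₀ ℓ₀ ϱ α B (splice) (splice) (ΘR₁ + (1+α)θ) (ΘN₁ + (1+α⁻¹)θ)` from: (near) per admissible word of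
  the box, `IsPathSystemOn … (‖e‖ ≤ D) (np₁ L w') (z₁ L w')` and `SchemeDominatedOnP … (‖e‖ ≤ D) (ΘR₁ L w') (ΘN₁ L w')` — the enumeration;
  (box) `‖gen₁ L‖ + ‖gen₂ L‖ + ℓ₀ ≤ ϱ` on the box (king steps are range pairs); (far) the ONE closed numeric inequality of
  `schemeDominatedOnP_remainder_king_far` at `(D, c₀, ϱ, nD, n₁, θ)` — e.g. `θ = 3/4000` at `(32, 37/50, 4, 9, 44)` (bc/RCR_inst32.lean).
  Downstream unchanged: tree `boxTailDebitP_of_scheme` (ZZZYRCH) turns it into `BoxTailDebitP … 0`, consumed by `uniformEquilStabilityAt_of_atlas`.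

Theorem file (3 defs `pathSpliceN` `pathSpliceZ` `IsPathSystemOn` — the last a `Prop`-valued CLASS-RESTRICTED variant of tree `IsPathSystem`,
not a new fact; 6 theorems); imports ZZZYRCR; no instance / notation / option; 0 sorry. [g99]
-/

open scoped BigOperators

namespace Summit.AtomisticToContinuum.Crystallization.Theorems.ChartedZeroExcessLayeredLatticeLiouville

open Summit.AtomisticToContinuum.Crystallization.Theorems.ChartedPlanarOrderRigidityDoor (E3)

/-! ### §1 Splicing two path systems at bond length `D` -/

/-- spliced piece counts: `np₁` on pairs of bond length `≤ D`, `np₂` beyond. [g99] -/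
noncomputable def pathSpliceN (D : ℝ) (a b : E3) (w : ℤ → E3) (np₁ np₂ : (Cell 2 × ℤ) × (Cell 2 × ℤ) → ℕ)
    (x : (Cell 2 × ℤ) × (Cell 2 × ℤ)) : ℕ :=
  if ‖bondVec a b w x‖ ≤ D then np₁ x else np₂ x

/-- spliced node sequences: `z₁ x` on pairs of bond length `≤ D`, `z₂ x` beyond. [g99] -/
noncomputable def pathSpliceZ (D : ℝ) (a b : E3) (w : ℤ → E3) (z₁ z₂ : (Cell 2 × ℤ) × (Cell 2 × ℤ) → ℕ → Cell 2 × ℤ)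
    (x : (Cell 2 × ℤ) × (Cell 2 × ℤ)) : ℕ → Cell 2 × ℤ :=
  if ‖bondVec a b w x‖ ≤ D then z₁ x else z₂ x

/-- the path-system clauses of tree `IsPathSystem`, asked only for far pairs in the class `P`. [g99] -/
def IsPathSystemOn (ϱ : ℝ) (a b : E3) (w : ℤ → E3) (P : (Cell 2 × ℤ) × (Cell 2 × ℤ) → Prop)
    (np : (Cell 2 × ℤ) × (Cell 2 × ℤ) → ℕ) (z : (Cell 2 × ℤ) × (Cell 2 × ℤ) → ℕ → Cell 2 × ℤ) : Prop :=
  ∀ x : (Cell 2 × ℤ) × (Cell 2 × ℤ), ϱ < ‖bondVec a b w x‖ → P x →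
    z x 0 = x.1 ∧ z x (np x) = x.2 ∧ ∀ i < np x, 0 < ‖bondVec a b w (piece z x i)‖ ∧ ‖bondVec a b w (piece z x i)‖ ≤ ϱ

/-- a path system is one on every class. [g99] -/
theorem isPathSystemOn_of {ϱ : ℝ} {a b : E3} {w : ℤ → E3} {np : (Cell 2 × ℤ) × (Cell 2 × ℤ) → ℕ}
    {z : (Cell 2 × ℤ) × (Cell 2 × ℤ) → ℕ → Cell 2 × ℤ} (h : IsPathSystem ϱ a b w np z) (P : (Cell 2 × ℤ) × (Cell 2 × ℤ) → Prop) :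
    IsPathSystemOn ϱ a b w P np z :=
  fun x hx _ => h x hx

/-- ★ the splice of a near and a far path system is a path system. [g99] -/
theorem isPathSystem_splice {ϱ D : ℝ} {a b : E3} {w : ℤ → E3} {np₁ np₂ : (Cell 2 × ℤ) × (Cell 2 × ℤ) → ℕ}
    {z₁ z₂ : (Cell 2 × ℤ) × (Cell 2 × ℤ) → ℕ → Cell 2 × ℤ}
    (h₁ : IsPathSystemOn ϱ a b w (fun x => ‖bondVec a b w x‖ ≤ D) np₁ z₁)
    (h₂ : IsPathSystemOn ϱ a b w (fun x => D < ‖bondVec a b w x‖) np₂ z₂) :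
    IsPathSystem ϱ a b w (pathSpliceN D a b w np₁ np₂) (pathSpliceZ D a b w z₁ z₂) := by
  intro x hx
  by_cases hD : ‖bondVec a b w x‖ ≤ D
  · have hn : pathSpliceN D a b w np₁ np₂ x = np₁ x := if_pos hD
    have hz : pathSpliceZ D a b w z₁ z₂ x = z₁ x := if_pos hD
    unfold piece; rw [hn, hz]; exact h₁ x hx hD
  · have hD' : D < ‖bondVec a b w x‖ := lt_of_not_ge hD
    have hn : pathSpliceN D a b w np₁ np₂ x = np₂ x := if_neg hD
    have hz : pathSpliceZ D a b w z₁ z₂ x = z₂ x := if_neg hD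
    unfold piece; rw [hn, hz]; exact h₂ x hx hD'

/-- the scheme sums contributed by a pair `x` depend on the path data only through `np x` and `z x`. [g99] -/
theorem schemeSums_congr {α : ℝ} {a b : E3} {w : ℤ → E3} {np np' : (Cell 2 × ℤ) × (Cell 2 × ℤ) → ℕ}
    {z z' : (Cell 2 × ℤ) × (Cell 2 × ℤ) → ℕ → Cell 2 × ℤ} {x : (Cell 2 × ℤ) × (Cell 2 × ℤ)} (hn : np x = np' x) (hz : z x = z' x)
    (y : (Cell 2 × ℤ) × (Cell 2 × ℤ)) :
    (∑ i ∈ Finset.range (np x), (if piece z x i = y then schemeCoefR α a b w np z x i else 0)) =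
        ∑ i ∈ Finset.range (np' x), (if piece z' x i = y then schemeCoefR α a b w np' z' x i else 0) ∧
      (∑ i ∈ Finset.range (np x), (if piece z x i = y then schemeCoefN α a b w np z x i else 0)) =
        ∑ i ∈ Finset.range (np' x), (if piece z' x i = y then schemeCoefN α a b w np' z' x i else 0) := by
  unfold schemeCoefR schemeCoefN cosSq piece
  rw [hn, hz]
  exact ⟨rfl, rfl⟩

/-- class-wise domination of the NEAR system passes to the splice. [g99] -/
theorem schemeDominatedOnP_splice_le {ϱ α D : ℝ} {a b : E3} {w : ℤ → E3} {np₁ np₂ : (Cell 2 × ℤ) × (Cell 2 × ℤ) → ℕ}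
    {z₁ z₂ : (Cell 2 × ℤ) × (Cell 2 × ℤ) → ℕ → Cell 2 × ℤ} {ΘR ΘN : (Cell 2 × ℤ) × (Cell 2 × ℤ) → ℝ}
    (h : SchemeDominatedOnP ϱ α a b w np₁ z₁ (fun x => ‖bondVec a b w x‖ ≤ D) ΘR ΘN) :
    SchemeDominatedOnP ϱ α a b w (pathSpliceN D a b w np₁ np₂) (pathSpliceZ D a b w z₁ z₂) (fun x => ‖bondVec a b w x‖ ≤ D) ΘR ΘN := by
  intro X hX y
  have e : ∀ x ∈ X, _ := fun x hx =>
    schemeSums_congr (α := α) (a := a) (b := b) (w := w) (show pathSpliceN D a b w np₁ np₂ x = np₁ x from if_pos (hX x hx).2)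
      (show pathSpliceZ D a b w z₁ z₂ x = z₁ x from if_pos (hX x hx).2) y
  rw [Finset.sum_congr rfl fun x hx => (e x hx).1, Finset.sum_congr rfl fun x hx => (e x hx).2]
  exact h X hX y

/-- class-wise domination of the FAR system passes to the splice. [g99] -/
theorem schemeDominatedOnP_splice_gt {ϱ α D : ℝ} {a b : E3} {w : ℤ → E3} {np₁ np₂ : (Cell 2 × ℤ) × (Cell 2 × ℤ) → ℕ}
    {z₁ z₂ : (Cell 2 × ℤ) × (Cell 2 × ℤ) → ℕ → Cell 2 × ℤ} {ΘR ΘN : (Cell 2 × ℤ) × (Cell 2 × ℤ) → ℝ}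
    (h : SchemeDominatedOnP ϱ α a b w np₂ z₂ (fun x => D < ‖bondVec a b w x‖) ΘR ΘN) :
    SchemeDominatedOnP ϱ α a b w (pathSpliceN D a b w np₁ np₂) (pathSpliceZ D a b w z₁ z₂) (fun x => D < ‖bondVec a b w x‖) ΘR ΘN := by
  intro X hX y
  have e : ∀ x ∈ X, _ := fun x hx =>
    schemeSums_congr (α := α) (a := a) (b := b) (w := w)
      (show pathSpliceN D a b w np₁ np₂ x = np₂ x from if_neg (not_le.mpr (hX x hx).2))
      (show pathSpliceZ D a b w z₁ z₂ x = z₂ x from if_neg (not_le.mpr (hX x hx).2)) y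
  rw [Finset.sum_congr rfl fun x hx => (e x hx).1, Finset.sum_congr rfl fun x hx => (e x hx).2]
  exact h X hX y

/-! ### §2 The box reader -/

/-- ★★ **THE PER-BOX READER**: on a box `B` of the atlas, the K-file's NEAR enumeration (its own rule `z₁, np₁`, class `‖e‖ ≤ D`, tables
`ΘR₁, ΘN₁` per word), the box fact `‖gen₁ L‖ + ‖gen₂ L‖ + ℓ₀ ≤ ϱ`, and the ONE closed numeric far-remainder inequality give `BoxSchemeP` for the
spliced system with tables `ΘR₁ + (1+α)θ`, `ΘN₁ + (1+α⁻¹)θ`.  (`c₀, ℓ₀` are the chain's; co-Lipschitz and offset-Lipschitz come from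
`IsAdmissibleWord`.) [g99] -/
theorem boxSchemeP_of_split {s Λ c₀ ℓ₀ ϱ α D θ : ℝ} (hα : 0 < α) (hc : 0 < c₀) (hϱ0 : 0 < ϱ) (hD : 0 < D) {nD n₁ : ℕ}
    (hnD : (nD : ℝ) - 1 ≤ D / ϱ) (h2 : 2 ≤ n₁) (hnD₁ : nD ≤ n₁)
    (hθ : ∑ n ∈ Finset.Ico nD n₁, (2 * (n : ℝ) * (n + 1) * (2 * n + 1) / 3) * (7 * (n : ℝ) / D ^ 8) +
        14 * ((n₁ : ℝ) + 1) * (2 * n₁ + 1) / (9 * c₀ ^ 8 * (n₁ : ℝ) ^ 2 * ((n₁ : ℝ) - 1) ^ 3) ≤ θ)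
    {B : (E3 ≃L[ℝ] E3) → (ℤ → E3) → Prop} {np₁ : (E3 ≃L[ℝ] E3) → (ℤ → E3) → (Cell 2 × ℤ) × (Cell 2 × ℤ) → ℕ}
    {z₁ : (E3 ≃L[ℝ] E3) → (ℤ → E3) → (Cell 2 × ℤ) × (Cell 2 × ℤ) → ℕ → Cell 2 × ℤ}
    {ΘR₁ ΘN₁ : (E3 ≃L[ℝ] E3) → (ℤ → E3) → (Cell 2 × ℤ) × (Cell 2 × ℤ) → ℝ}
    (hgen : ∀ (L : E3 ≃L[ℝ] E3) (w' : ℤ → E3), B L w' → ‖gen₁ L‖ + ‖gen₂ L‖ + ℓ₀ ≤ ϱ)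
    (hnear : ∀ a : ℝ, 0 < a → ∀ (L : E3 ≃L[ℝ] E3) (w' : ℤ → E3), IsAdmissibleWord a s Λ c₀ ℓ₀ L w' → B L w' →
      IsPathSystemOn ϱ (gen₁ L) (gen₂ L) w' (fun x => ‖bondVec (gen₁ L) (gen₂ L) w' x‖ ≤ D) (np₁ L w') (z₁ L w') ∧
        SchemeDominatedOnP ϱ α (gen₁ L) (gen₂ L) w' (np₁ L w') (z₁ L w') (fun x => ‖bondVec (gen₁ L) (gen₂ L) w' x‖ ≤ D)
          (ΘR₁ L w') (ΘN₁ L w')) :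
    BoxSchemeP s Λ c₀ ℓ₀ ϱ α B (fun L w' => pathSpliceN D (gen₁ L) (gen₂ L) w' (np₁ L w') kingN)
      (fun L w' => pathSpliceZ D (gen₁ L) (gen₂ L) w' (z₁ L w') kingZ)
      (fun L w' y => ΘR₁ L w' y + (1 + α) * θ) (fun L w' y => ΘN₁ L w' y + (1 + α⁻¹) * θ) := by
  intro a ha L w' hA hB
  obtain ⟨hP₁, hS₁⟩ := hnear a ha L w' hA hB
  have hw : IsLayeredCrystal c₀ (gen₁ L) (gen₂ L) w' := hA.2.2.2.1
  have hlip : ∀ m : ℤ, ‖w' (m + 1) - w' m‖ ≤ ℓ₀ := hA.2.2.2.2.1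
  have hϱ := hgen L w' hB
  have hfar := schemeDominatedOnP_remainder_king_far (θ := θ) hα hc hw hlip hϱ hϱ0 hD hnD h2 hnD₁ hθ
  exact ⟨isPathSystem_splice hP₁ (isPathSystemOn_of (isPathSystem_king hc hw hlip hϱ) _),
    schemeDominatedP_of_split D (schemeDominatedOnP_splice_le hS₁) (schemeDominatedOnP_splice_gt hfar)⟩

end Summit.AtomisticToContinuum.Crystallization.Theorems.ChartedZeroExcessLayeredLatticeLiouville
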